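import Literature.AnabelianGeometry.EtaleTheta.ThetaKummerInputOfExponentCocycle
import Literature.AnabelianGeometry.EtaleTheta.CocycleExtensionAlongZ
import Literature.AnabelianGeometry.EtaleTheta.SettingModelExpRatPow
import Literature.AnabelianGeometry.EtaleTheta.SettingModelTateDeckLevels
import Literature.AnabelianGeometry.EtaleTheta.SettingModelTateCyclotomes
import Literature.AnabelianGeometry.EtaleTheta.SettingModelChiCyclotomes
import HarnessLib

/-!
# The «`c·Ü^r·Θ̈^s`» FUNCTION MODULE AT THE STAGE-2 (Tate) MODEL `modelχq p 1 2`: the exponent cocycle from the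
# `y`/`z`-coordinates, and [EtTh] Prop 1.5 (iii) at `η̈♯ = etaDdχq` RE-DERIVED through the Kummer theory of functions

S. Mochizuki, *The étale theta function and its Frobenioid-theoretic manifestations*, Publ. RIMS **45** (2009) [EtTh],
§1 Prop 1.4 (ii) p. 22 («`Θ̈(q_X^{a/2} Ü) = (−1)^a q_X^{−a²/2} Ü^{−2a} Θ̈(Ü)`»), Prop 1.5 (iii) p. 23 (the `Z`-action display;
«Assertion (iii) follows from Propositions 1.3; 1.4, (ii), (iii)») [cite: MochizukiEtTh2009, Prop 1.5 (iii) p.23].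
abc-iut cell, layer L2, seat abc-iut-L2-t12 (gen 8), row (β) «NV TWIN of p458029» — part 3b (PROOF-ONLY: no definition,
no instance, no `Prop` fact). Inputs BY NAME: part 1 `KummerCore.exists_thetaKummerInput_of_exponentCocycle` (p470443),
part 2 `CrossedHomExtension.exists_crossedHom_extension_of_zpowers` (p472509), part 3a `expZH` / `pRatPow`
(`SettingModelExpRatPow`); abc-iut-L2-t5's F5q `ThetaSetting.modelχq` (`Π^tp_X = Γ ⋊_{(κ_p, κ_p², χ)} G_{ℚ_p}`), abc-iut-w5-d171's
F6q `kummerCoreχq` / `yCoordKitχq` / `yCoordχq`, abc-iut-L2-t6's F7q `zFunχq` / `zClassYddχq` / `etaDdχq` and their LEVEL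
ARITHMETIC of the deck conjugation (`yCoordχq_deckConj`: `ŷ(σ₀⁻¹gσ₀) = ŷ(g)·κ_p²`; `toTheta_inl_zRepr_deckConj`: the `z`-part
moves by `c^{−ŷ(g)}·c^{−κ_p}`, `SettingModelTateDeckLevels`), abc-iut-L6-d6's `deltaThetaCoordχq`. Nothing restated.

WHAT. At `D := modelχq p 1 2` with deck generator `σ₀ = (a, 1)`:
* the `Π^tp_Y`-cocycle `φ(g) := [(r, s) ↦ exp(ŷ(g)·r/2) · exp(ζ(g)·s)]` (`ζ` = the `Ẑ`-coordinate of L2-t6's `z`-part,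
  `exp = expZH`) in the exponent module `Hom(ℚ², ℚ̄_pˣ)` (action `g ⋆ F = aug(g) ∘ F ∘ u_g⁻¹`) and the value
  `m := [(r, s) ↦ p^r · p^s]` at `σ₀` satisfy the compatibility of part 2 — THIS IS EXACTLY the level arithmetic
  `ŷ ↦ ŷ + 2κ_p`, `z ↦ z − ŷ − κ_p` of abc-iut-L2-t6 plus the Galois law `σ•p^t = exp(κ_p(σ) t)·p^t` — so they extend
  to an exponent cocycle `B` on `Π^tp_X` (`exists_exponentCocycle_modelTate`) with ALL hypotheses of part 1:
  locally constant on `Π^tp_Y`, `Π^tp_Y`-values `±1` / `1`, `Π^tp_Ÿ`-values on the roots = Kummer characters of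
  `log(Ü) = c^{ŷ/2}` and of the `z`-class, `B(σ₀) = (q̈, q̈⁻¹)` on the generators (`q̈ = p`);
* hence (`exists_thetaKummerInput_functionModule_modelTate`) a `ThetaKummerInput` at `modelχq p 1 2` — the monomial
  module «`c·Ü^r·Θ̈^s`» — with GENUINE `κ(Θ̈) = etaDdχq`, `ConstCompat kummerDataχq`, `infl log(Ü) = κ(Ü)`, and the four
  FUNCTION identities of Prop 1.4 (ii) (`σ₀•Ü = q̈·Ü`, `y•Ü = ±Ü`, `σ₀•Θ̈ = q̈⁻¹·Ü⁻²·Θ̈`, `y•Θ̈ = Θ̈`) — the NON-VACUITY TWIN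
  of abc-iut-L2-t12's function-level Prop 1.5 (iii) theorem (p458029): its ELEVEN binders are JOINTLY INHABITED at one
  datum; and (`prop15iii_etaDdχq_of_functionModule`) **Prop 1.5 (iii) at `η̈♯ = etaDdχq p 1 2` re-derived THROUGH the
  Kummer theory of functions** (abc-iut-L2-t6's F7q reached it by class-level displays).
HONEST FRAMING: SEMI-SYNTHETIC model — consistency / non-vacuity evidence for the typed [EtTh] §1 interface ONLY; at this
model the deck transformation FIXES `Θ̈` (unit `+1`, print: `−1`) — an instance of the binder `hΘY`, not of print's sign;
nothing of [EtTh] is asserted; typed ≠ proved; no side is taken on [IUTchIII] Cor 3.12.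
-/

noncomputable section

namespace Literature.AnabelianGeometry.EtaleTheta.SettingModel

open Literature.AnabelianGeometry.SemiGraphs _root_.Topology _root_.Function

variable (p : ℕ) [Fact p.Prime]

/-- **The exponent cocycle of the theta function module at `modelχq p 1 2`.** There is
`B : Π^tp_X → Hom(ℚ × ℚ, ℚ̄_pˣ)` satisfying EVERY hypothesis of part 1's `exists_thetaKummerInput_of_exponentCocycle` at
the stage-2 model: the cocycle law for `g ⋆ F = aug(g) ∘ F ∘ u_g⁻¹`; local constancy on `Π^tp_Y`; `Π^tp_Y`-values `±1` resp.
`1` on the generators; `Π^tp_Ÿ`-values on the roots = the Kummer characters of `log(Ü) = ι(ŷ/2)` (abc-iut-w5-d171's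
`yCoordKitχq`) and of the `z`-cocycle (abc-iut-L2-t6's `zFunχq`); `B(σ₀)(1,0) = q̈`, `B(σ₀)(−2,1) = q̈⁻¹` at `σ₀ = (a, 1)`.
Construction: part 2 applied to `φ(g)(r,s) = expZH(ŷ g)(r/2)·expZH(ζ g)(s)` on `Π^tp_Y` and `m(r,s) = p^r·p^s`, the
compatibility being abc-iut-L2-t6's deck level arithmetic. [cite: MochizukiEtTh2009, Prop 1.5 (iii) p.23] -/
theorem exists_exponentCocycle_modelTate :
    ∃ B : PiTpχq p 1 2 → (Multiplicative ℚ × Multiplicative ℚ →* (PadicAlgCl p)ˣ),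
      (∀ (g h : PiTpχq p 1 2) (v : Multiplicative ℚ × Multiplicative ℚ),
        B (g * h) v = B g v * (ThetaSetting.modelχq p 1 2 even_two).aug g •
          B h (v.1 * v.2 ^ (2 * Multiplicative.toAdd ((ThetaSetting.modelχq p 1 2 even_two).toZ g)), v.2)) ∧
      (∀ v : Multiplicative ℚ × Multiplicative ℚ,
        IsOpen {g : PiTpχq p 1 2 | g ∈ (ThetaSetting.modelχq p 1 2 even_two).GtpY ∧ B g v = 1}) ∧
      (∀ y ∈ (ThetaSetting.modelχq p 1 2 even_two).GtpY,
        B y (Multiplicative.ofAdd 1, 1) = 1 ∨ B y (Multiplicative.ofAdd 1, 1) = -1) ∧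
      (∀ y ∈ (ThetaSetting.modelχq p 1 2 even_two).GtpY, B y (1, Multiplicative.ofAdd 1) = 1) ∧
      (∀ (h : PiTpχq p 1 2) (hh : h ∈ (ThetaSetting.modelχq p 1 2 even_two).GtpYdd) (n : ℕ+),
        B h (Multiplicative.ofAdd ((1 : ℚ) / (n : ℕ)), 1) =
          (((cycEquiv p).symm (half ⟨(yCoordKitχq p 1 2 even_two).y
              ((ThetaSetting.modelχq p 1 2 even_two).toTheta h), (yCoordKitχq p 1 2 even_two).y_even _ ⟨h, hh, rfl⟩⟩) :
            cyclotome (PadicAlgCl p)ˣ) : ℕ+ → (PadicAlgCl p)ˣ) n) ∧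
      (∀ (h : PiTpχq p 1 2) (hh : h ∈ (ThetaSetting.modelχq p 1 2 even_two).GtpYdd) (n : ℕ+),
        B h (1, Multiplicative.ofAdd ((1 : ℚ) / (n : ℕ))) =
          (((MulEquiv.ofBijective (kummerCoreχq p 1 2 even_two).coeffHom
                (kummerCoreχq p 1 2 even_two).bijective_coeffHom).symm
              (zFunχq p 1 2 even_two _ le_rfl ⟨(ThetaSetting.modelχq p 1 2 even_two).toTheta h,
                (ThetaSetting.modelχq p 1 2 even_two).GtpYddTheta_le ⟨h, hh, rfl⟩⟩) :
            cyclotome (PadicAlgCl p)ˣ) : ℕ+ → (PadicAlgCl p)ˣ) n) ∧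
      B (SemidirectProduct.inl (gfpOf (FreeGroup.of 0))) (Multiplicative.ofAdd 1, 1) =
        1 * Units.mk0 (ThetaSetting.modelχq p 1 2 even_two).qdd (ThetaSetting.modelχq p 1 2 even_two).qdd_ne_zero ∧
      B (SemidirectProduct.inl (gfpOf (FreeGroup.of 0))) (Multiplicative.ofAdd (-2), Multiplicative.ofAdd 1) =
        (Units.mk0 (ThetaSetting.modelχq p 1 2 even_two).qdd (ThetaSetting.modelχq p 1 2 even_two).qdd_ne_zero)⁻¹ := by
  classical
  set D := ThetaSetting.modelχq p 1 2 even_two with hD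
  set σ₀ : PiTpχq p 1 2 := SemidirectProduct.inl (gfpOf (FreeGroup.of 0)) with hσ₀def
  have hσ₀ : D.toZ σ₀ = Multiplicative.ofAdd 1 := toZ_inl_gfpOf_a p 1 2 even_two
  have σ₀_right : σ₀.right = 1 := SemidirectProduct.right_inl _
  have aug_eq : ∀ g : PiTpχq p 1 2, D.aug g = g.right := fun _ => rfl
  let a : PiTpχq p 1 2 → ℤ := fun g => Multiplicative.toAdd (D.toZ g)
  have a_of_mem : ∀ {g}, g ∈ D.GtpY → a g = 0 := fun {g} hg => by
    show Multiplicative.toAdd (D.toZ g) = 0; rw [show D.toZ g = 1 from hg, toAdd_one]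
  have a_σ₀ : a σ₀ = 1 := by show Multiplicative.toAdd (D.toZ σ₀) = 1; rw [hσ₀, toAdd_ofAdd]
  have gfpSnd_of_mem : ∀ {g : PiTpχq p 1 2}, g ∈ D.GtpY → gfpSnd g.left = 1 :=
    fun hg => gfpSnd_left_eq_one_of_mem_gtpY_modelχq p 1 2 even_two hg
  have qdd_eq : Units.mk0 D.qdd D.qdd_ne_zero = pUnit p := Units.ext (by rw [Units.val_mk0, coe_pUnit])
  /- the exponent module `M := Hom(ℚ × ℚ, ℚ̄_pˣ)` with `g ⋆ F = aug(g) ∘ F ∘ u_g⁻¹` -/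
  let ush : PiTpχq p 1 2 → (Multiplicative ℚ × Multiplicative ℚ →* Multiplicative ℚ × Multiplicative ℚ) := fun g =>
    { toFun := fun v => (v.1 * v.2 ^ (2 * a g), v.2)
      map_one' := by simp
      map_mul' := fun v w => by
        simp only [Prod.fst_mul, Prod.snd_mul, Prod.mk_mul_mk, mul_zpow]
        rw [mul_mul_mul_comm] }
  have ush_apply : ∀ g v, ush g v = (v.1 * v.2 ^ (2 * a g), v.2) := fun _ _ => rfl
  have ush_snd : ∀ g v, (ush g v).2 = v.2 := fun _ _ => rfl
  have ush_of_mem : ∀ {g} (_ : g ∈ D.GtpY) v, ush g v = v := fun {g} hg v => by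
    rw [ush_apply, a_of_mem hg, mul_zero, zpow_zero, mul_one]
  have ush_mul : ∀ g h v, ush (g * h) v = ush h (ush g v) := fun g h v => by
    simp only [ush_apply]
    refine Prod.ext ?_ rfl
    show v.1 * v.2 ^ (2 * Multiplicative.toAdd (D.toZ (g * h))) = v.1 * v.2 ^ (2 * a g) * v.2 ^ (2 * a h)
    rw [map_mul, toAdd_mul, mul_assoc, ← zpow_add]; congr 2; ring
  let gal : PiTpχq p 1 2 → ((PadicAlgCl p)ˣ →* (PadicAlgCl p)ˣ) := fun g =>
    MulDistribMulAction.toMonoidHom (PadicAlgCl p)ˣ g.right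
  have gal_apply : ∀ g (u : (PadicAlgCl p)ˣ), gal g u = g.right • u := fun _ _ => rfl
  letI iM : SMul (PiTpχq p 1 2) (Multiplicative ℚ × Multiplicative ℚ →* (PadicAlgCl p)ˣ) :=
    ⟨fun g F => (gal g).comp (F.comp (ush g))⟩
  have smul_apply : ∀ (g : PiTpχq p 1 2) (F : Multiplicative ℚ × Multiplicative ℚ →* (PadicAlgCl p)ˣ) v,
      (g • F) v = g.right • F (ush g v) := fun _ _ _ => rfl
  letI instM : MulDistribMulAction (PiTpχq p 1 2) (Multiplicative ℚ × Multiplicative ℚ →* (PadicAlgCl p)ˣ) :=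
    { one_smul := fun F => MonoidHom.ext fun v => by
        rw [smul_apply, SemidirectProduct.one_right, one_smul, ush_apply]
        show F (v.1 * v.2 ^ (2 * Multiplicative.toAdd (D.toZ 1)), v.2) = F v
        rw [map_one, toAdd_one, mul_zero, zpow_zero, mul_one]
      mul_smul := fun g h F => MonoidHom.ext fun v => by
        rw [smul_apply, smul_apply, smul_apply, SemidirectProduct.mul_right, mul_smul, ush_mul]
      smul_mul := fun g F F' => MonoidHom.ext fun v => by
        rw [smul_apply, MonoidHom.mul_apply, MonoidHom.mul_apply, smul_apply, smul_apply, smul_mul']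
      smul_one := fun g => MonoidHom.ext fun v => by
        rw [smul_apply, MonoidHom.one_apply, MonoidHom.one_apply, smul_one] }
  /- the `Ẑ`-coordinate of the `z`-part on `Π^tp_Y` -/
  haveI : T2Space (CurveTheta.GTheta (curveχq p 1 2)) := CurveTheta.t2Space_GTheta (curveχq p 1 2)
  let δ : ZH ≃* D.DeltaTheta := MulEquiv.ofBijective (deltaThetaCoordχq p 1 2) (bijective_deltaThetaCoordχq p 1 2)
  have δ_apply : ∀ t, δ t = deltaThetaCoordχq p 1 2 t := fun _ => rfl
  let δₜ : ZH ≃ₜ D.DeltaTheta :=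
    Continuous.homeoOfEquivCompactToT2 (f := δ.toEquiv) (continuous_deltaThetaCoordχq p 1 2)
  have δ_symm_cont : Continuous δ.symm := δₜ.symm.continuous
  have coeff_symm : ∀ d : D.DeltaTheta, (MulEquiv.ofBijective (kummerCoreχq p 1 2 even_two).coeffHom
      (kummerCoreχq p 1 2 even_two).bijective_coeffHom).symm d = (cycEquiv p).symm (δ.symm d) := by
    intro d
    apply (MulEquiv.ofBijective (kummerCoreχq p 1 2 even_two).coeffHom
      (kummerCoreχq p 1 2 even_two).bijective_coeffHom).injective
    rw [MulEquiv.apply_symm_apply, MulEquiv.ofBijective_apply]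
    symm
    show deltaThetaCoordχq p 1 2 (cycEquiv p ((cycEquiv p).symm (δ.symm d))) = d
    rw [MulEquiv.apply_symm_apply, ← δ_apply, MulEquiv.apply_symm_apply]
  have conj_δ : ∀ (g : PiTpχq p 1 2) (t : ZH), MulAut.conjNormal (D.toTheta g) (δ t) = δ (chi p g.right t) :=
    fun g t => conjNormal_toTheta_deltaThetaCoordχq p 1 2 even_two g t
  let zY : ↥D.GtpY → D.DeltaTheta := fun h =>
    zFunχq p 1 2 even_two _ le_rfl ⟨D.toTheta h, ⟨h, h.2, rfl⟩⟩
  have coe_zY : ∀ h : ↥D.GtpY, ((zY h : D.DeltaTheta) : CurveTheta.GTheta (curveχq p 1 2)) =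
      zPartχq p 1 2 (D.toTheta h) := fun _ => rfl
  have zY_cont : Continuous zY :=
    ((continuous_zPartχq p 1 2).comp (D.continuous_toTheta.comp continuous_subtype_val)).subtype_mk _
  have zY_mul : ∀ g h : ↥D.GtpY, zY (g * h) = zY g * MulAut.conjNormal (D.toTheta g) (zY h) := fun g h => by
    have hc := (zFunχq_mem p 1 2 even_two _ le_rfl).2 ⟨D.toTheta g, ⟨g, g.2, rfl⟩⟩ ⟨D.toTheta h, ⟨h, h.2, rfl⟩⟩
    rw [MonoidHom.id_apply] at hc
    exact hc
  let ζ : ↥D.GtpY → ZH := fun h => δ.symm (zY h)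
  have ζ_cont : Continuous ζ := δ_symm_cont.comp zY_cont
  have ζ_mul : ∀ g h : ↥D.GtpY, ζ (g * h) = ζ g * chi p (g : PiTpχq p 1 2).right (ζ h) := fun g h => by
    show δ.symm (zY (g * h)) = δ.symm (zY g) * chi p (g : PiTpχq p 1 2).right (δ.symm (zY h))
    rw [zY_mul]
    conv_lhs => rw [← δ.apply_symm_apply (zY g), ← δ.apply_symm_apply (zY h), conj_δ, ← map_mul, δ.symm_apply_apply]
  /- the `y`-coordinate -/
  let yC : PiTpχq p 1 2 → ZH := fun g => yThetaχq p 1 2 (D.toTheta g)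
  have yC_apply : ∀ g, yC g = yCoordχq p 1 2 g := fun _ => rfl
  have yC_mul : ∀ (g h : PiTpχq p 1 2), h ∈ D.GtpY → yC (g * h) = yC g * chi p g.right (yC h) := fun g h hh => by
    rw [yC_apply, yC_apply, yC_apply]
    exact yCoordχq_mul_of_eHat_eq_one p 1 2 g h (eHat_gfpFst_left_eq_one p 1 2 (gfpSnd_of_mem hh))
  /- the deck conjugation on `Π^tp_Y` (abc-iut-L2-t6's level arithmetic) -/
  have deck_mem : ∀ {g}, g ∈ D.GtpY → σ₀⁻¹ * g * σ₀ ∈ D.GtpY := fun {g} hg => by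
    show D.toZ (σ₀⁻¹ * g * σ₀) = 1
    rw [map_mul, map_mul, map_inv, show D.toZ g = 1 from hg, mul_one, inv_mul_cancel]
  have yC_deck : ∀ {g} (hg : g ∈ D.GtpY), yC (σ₀⁻¹ * g * σ₀) = yC g * kappaP p g.right ^ (2 : ℤ) :=
    fun {g} hg => yCoordχq_deckConj p 1 2 (gfpSnd_of_mem hg)
  have deck_right : ∀ g : PiTpχq p 1 2, (σ₀⁻¹ * g * σ₀).right = g.right := fun g => by
    rw [SemidirectProduct.mul_right, SemidirectProduct.mul_right, SemidirectProduct.inv_right, σ₀_right, inv_one,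
      one_mul, mul_one]
  have zY_deck : ∀ (g : ↥D.GtpY),
      ((zY ⟨σ₀⁻¹ * g * σ₀, deck_mem g.2⟩ : D.DeltaTheta) : CurveTheta.GTheta (curveχq p 1 2)) =
        zPartχq p 1 2 (D.toTheta g) * (cThetaχq p 1 2 (yC g))⁻¹ *
          (cThetaχq p 1 2 (kappaP p (g : PiTpχq p 1 2).right))⁻¹ := fun g => by
    rw [coe_zY, zPartχq_toTheta]
    show CurveTheta.toTheta (curveχq p 1 2) (SemidirectProduct.inl ((σ₀⁻¹ * g * σ₀).left *
        (bPowGfp (eHatB (gfpFst (σ₀⁻¹ * g * σ₀).left)))⁻¹)) = _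
    rw [deckConj_eq, zPartχq_toTheta]
    exact toTheta_inl_zRepr_deckConj p 2 (gfpSnd_of_mem g.2)
  have ζ_deck : ∀ (g : ↥D.GtpY), ζ ⟨σ₀⁻¹ * g * σ₀, deck_mem g.2⟩ =
      ζ g * (yC g)⁻¹ * (kappaP p (g : PiTpχq p 1 2).right)⁻¹ := fun g => by
    show δ.symm (zY _) = _
    rw [MulEquiv.symm_apply_eq]
    apply Subtype.ext
    rw [zY_deck, map_mul, map_mul, map_inv, map_inv, MulEquiv.apply_symm_apply, Subgroup.coe_mul, Subgroup.coe_mul,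
      Subgroup.coe_inv, Subgroup.coe_inv, coe_zY, δ_apply, δ_apply, coe_deltaThetaCoordχq, coe_deltaThetaCoordχq]
  /- halving on `ℚ` -/
  let halfQ : Multiplicative ℚ →* Multiplicative ℚ := AddMonoidHom.toMultiplicative (AddMonoidHom.mulLeft ((1 : ℚ) / 2))
  have halfQ_apply : ∀ q : ℚ, halfQ (Multiplicative.ofAdd q) = Multiplicative.ofAdd (q / 2) := fun q => by
    show Multiplicative.ofAdd ((1 : ℚ) / 2 * q) = _; rw [one_div_mul_eq_div]
  /- the cocycle `φ` on `Π^tp_Y` -/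
  let φ : PiTpχq p 1 2 → (Multiplicative ℚ × Multiplicative ℚ →* (PadicAlgCl p)ˣ) := fun g =>
    if hg : g ∈ D.GtpY then
      (expZH p (yC g)).comp (halfQ.comp (MonoidHom.fst _ _)) * (expZH p (ζ ⟨g, hg⟩)).comp (MonoidHom.snd _ _)
    else 1
  have φ_apply : ∀ (g) (hg : g ∈ D.GtpY) (v : Multiplicative ℚ × Multiplicative ℚ),
      φ g v = expZH p (yC g) (halfQ v.1) * expZH p (ζ ⟨g, hg⟩) v.2 := fun g hg v => by
    show (dite _ _ _ : Multiplicative ℚ × Multiplicative ℚ →* (PadicAlgCl p)ˣ) v = _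
    rw [dif_pos hg]; rfl
  have hφ : ∀ n ∈ D.toZ.ker, ∀ n' ∈ D.toZ.ker, φ (n * n') = φ n * n • φ n' := by
    intro n hn n' hn'
    have hnn' : n * n' ∈ D.GtpY := D.GtpY.mul_mem hn hn'
    refine MonoidHom.ext fun v => ?_
    rw [MonoidHom.mul_apply, smul_apply, ush_of_mem hn, φ_apply _ hnn', φ_apply _ hn, φ_apply _ hn', yC_mul n n' hn',
      show ζ ⟨n * n', hnn'⟩ = ζ (⟨n, hn⟩ * ⟨n', hn'⟩) from rfl, ζ_mul, expZH_mul, expZH_mul, expZH_chi, expZH_chi,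
      smul_mul']
    show _ = _ * (n.right • _ * n.right • _)
    rw [mul_mul_mul_comm]
  /- the value at `σ₀` and the compatibility -/
  let m : Multiplicative ℚ × Multiplicative ℚ →* (PadicAlgCl p)ˣ :=
    (pRatPow p).comp (MonoidHom.fst _ _) * (pRatPow p).comp (MonoidHom.snd _ _)
  have m_apply : ∀ v : Multiplicative ℚ × Multiplicative ℚ, m v = pRatPow p v.1 * pRatPow p v.2 := fun _ => rfl
  have halfQ_ush_σ₀ : ∀ v : Multiplicative ℚ × Multiplicative ℚ, halfQ (ush σ₀ v).1 = halfQ v.1 * v.2 := fun v => by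
    rw [ush_apply, a_σ₀, mul_one, map_mul]
    congr 1
    rw [← ofAdd_toAdd v.2, ← ofAdd_zsmul, halfQ_apply, zsmul_eq_mul, Int.cast_ofNat, mul_div_cancel_left₀ _ two_ne_zero]
  have hcompat : ∀ n ∈ D.toZ.ker, φ (σ₀ * n * σ₀⁻¹) = m * σ₀ • φ n * ((σ₀ * n * σ₀⁻¹) • m)⁻¹ := by
    intro n hn
    -- write `n = σ₀⁻¹ g σ₀` with `g ∈ Π^tp_Y`
    set g : PiTpχq p 1 2 := σ₀ * n * σ₀⁻¹ with hgdef
    have hg : g ∈ D.GtpY := by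
      show D.toZ (σ₀ * n * σ₀⁻¹) = 1
      rw [map_mul, map_mul, map_inv, show D.toZ n = 1 from hn, mul_one, mul_inv_cancel]
    have hn_eq : n = σ₀⁻¹ * g * σ₀ := by rw [hgdef]; group
    have hn' : σ₀⁻¹ * g * σ₀ ∈ D.GtpY := deck_mem hg
    have hy : yC n = yC g * kappaP p g.right ^ (2 : ℤ) := by rw [hn_eq]; exact yC_deck hg
    have hz : ζ ⟨n, hn⟩ = ζ ⟨g, hg⟩ * (yC g)⁻¹ * (kappaP p g.right)⁻¹ := by
      rw [show (⟨n, hn⟩ : ↥D.GtpY) = ⟨σ₀⁻¹ * g * σ₀, hn'⟩ from Subtype.ext hn_eq]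
      exact ζ_deck ⟨g, hg⟩
    have e1 : ∀ v : Multiplicative ℚ × Multiplicative ℚ,
        expZH p (kappaP p g.right ^ (2 : ℤ)) (halfQ v.1) = expZH p (kappaP p g.right) v.1 := fun v => by
      rw [← ofAdd_toAdd v.1, halfQ_apply, zpow_ofNat, expZH_sq_half]
    have e2 : ∀ v : Multiplicative ℚ × Multiplicative ℚ,
        expZH p (kappaP p g.right ^ (2 : ℤ)) v.2 = expZH p (kappaP p g.right) v.2 ^ (2 : ℤ) := fun v => by
      rw [expZH_zpow]
    refine MonoidHom.ext fun v => ?_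
    rw [MonoidHom.mul_apply, MonoidHom.mul_apply, MonoidHom.inv_apply, smul_apply, smul_apply, σ₀_right, one_smul,
      ush_of_mem hg, φ_apply g hg, φ_apply n hn, halfQ_ush_σ₀, ush_snd, map_mul, m_apply, smul_mul', smul_pRatPow,
      smul_pRatPow, hy, hz]
    simp only [expZH_mul, expZH_inv, e1, e2]
    apply Additive.ofMul.injective
    simp only [ofMul_mul, ofMul_inv, ofMul_zpow]
    abel
  /- the extension -/
  obtain ⟨B, hBc, hBN, hBσ₀⟩ := CrossedHomExtension.exists_crossedHom_extension_of_zpowers D.toZ σ₀ hσ₀ φ hφ m hcompat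
  have hBY : ∀ (g) (hg : g ∈ D.GtpY) (v : Multiplicative ℚ × Multiplicative ℚ),
      B g v = expZH p (yC g) (halfQ v.1) * expZH p (ζ ⟨g, hg⟩) v.2 := fun g hg v => by
    rw [hBN g hg, φ_apply g hg]
  refine ⟨B, fun g h v => ?_, fun v => ?_, fun y hy => ?_, fun y hy => ?_, fun h hh n => ?_, fun h hh n => ?_, ?_, ?_⟩
  · -- the cocycle law in part 1's shape
    rw [hBc, MonoidHom.mul_apply, smul_apply, aug_eq, ush_apply]
  · -- local constancy on `Π^tp_Y`
    have hYopen : IsOpen (D.GtpY : Set (PiTpχq p 1 2)) := D.isOpen_ker_toZ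
    let Φ : ↥D.GtpY → (PadicAlgCl p)ˣ := fun h => expZH p (yC h) (halfQ v.1) * expZH p (ζ h) v.2
    have Φ_apply : ∀ h : ↥D.GtpY, Φ h = expZH p (yC h) (halfQ v.1) * expZH p (ζ h) v.2 := fun _ => rfl
    have hset : {g : PiTpχq p 1 2 | g ∈ D.GtpY ∧ B g v = 1} = Subtype.val '' (Φ ⁻¹' {1}) := by
      ext g
      constructor
      · rintro ⟨hg, hB⟩
        refine ⟨⟨g, hg⟩, ?_, rfl⟩
        rw [Set.mem_preimage, Set.mem_singleton_iff, Φ_apply, ← hBY g hg]; exact hB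
      · rintro ⟨h, hh, rfl⟩
        rw [Set.mem_preimage, Set.mem_singleton_iff, Φ_apply] at hh; exact ⟨h.2, by rw [hBY h h.2]; exact hh⟩
    rw [hset]
    refine hYopen.isOpenMap_subtype_val _ ?_
    rw [isOpen_iff_forall_mem_open]
    intro h₀ hh₀
    rw [Set.mem_preimage, Set.mem_singleton_iff] at hh₀
    refine ⟨(fun h : ↥D.GtpY => yC h * (yC h₀)⁻¹) ⁻¹'
        ((ZHatLevel.level (denP (Multiplicative.toAdd (halfQ v.1)))).ker : Set ZH) ∩
        (fun h : ↥D.GtpY => ζ h * (ζ h₀)⁻¹) ⁻¹' ((ZHatLevel.level (denP (Multiplicative.toAdd v.2))).ker : Set ZH),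
      fun h hh => ?_, ?_, ?_⟩
    · obtain ⟨h1, h2⟩ := hh
      rw [Set.mem_preimage, SetLike.mem_coe, MonoidHom.mem_ker, map_mul, map_inv, mul_inv_eq_one] at h1 h2
      rw [Set.mem_preimage, Set.mem_singleton_iff, Φ_apply, ← hh₀, Φ_apply, ← ofAdd_toAdd (halfQ v.1),
        ← ofAdd_toAdd v.2, expZH_eq_of_level_eq p _ h1, expZH_eq_of_level_eq p _ h2]
    · refine IsOpen.inter ?_ ?_
      · exact (ZHatLevel.isOpen_ker_level _).preimage
          ((((continuous_yThetaχq p 1 2).comp (D.continuous_toTheta.comp continuous_subtype_val))).mul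
            continuous_const)
      · exact (ZHatLevel.isOpen_ker_level _).preimage (ζ_cont.mul continuous_const)
    · exact ⟨by rw [Set.mem_preimage, SetLike.mem_coe, mul_inv_cancel]; exact one_mem _,
        by rw [Set.mem_preimage, SetLike.mem_coe, mul_inv_cancel]; exact one_mem _⟩
  · -- `B y (1,0) = ±1`
    rw [hBY y hy]; dsimp only; rw [(expZH p (ζ ⟨y, hy⟩)).map_one, mul_one, halfQ_apply]
    exact expZH_half_eq_one_or p (yC y)
  · -- `B y (0,1) = 1`
    rw [hBY y hy]; dsimp only; rw [halfQ.map_one, (expZH p (yC y)).map_one, one_mul, expZH_ofAdd_one]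
  · -- the Kummer character of `log(Ü) = ι(ŷ/2)`
    have hY : h ∈ D.GtpY := D.GtpYdd_le_GtpY hh
    rw [hBY h hY]
    dsimp only
    rw [(expZH p (ζ ⟨h, hY⟩)).map_one, mul_one, halfQ_apply]
    have hsq : yC h = (half ⟨(yCoordKitχq p 1 2 even_two).y (D.toTheta h),
        (yCoordKitχq p 1 2 even_two).y_even _ ⟨h, hh, rfl⟩⟩) ^ 2 := by
      rw [half_sq]; rfl
    rw [hsq, expZH_sq_half, expZH_ofAdd_inv]
  · -- the Kummer character of the `z`-class
    have hY : h ∈ D.GtpY := D.GtpYdd_le_GtpY hh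
    rw [hBY h hY]
    dsimp only
    rw [halfQ.map_one, (expZH p (yC h)).map_one, one_mul, expZH_ofAdd_inv, coeff_symm]
  · -- `B σ₀ (1,0) = q̈`
    rw [hBσ₀, m_apply]; dsimp only; rw [(pRatPow p).map_one, mul_one, pRatPow_ofAdd_one, one_mul, qdd_eq]
  · -- `B σ₀ (−2,1) = q̈⁻¹`
    rw [hBσ₀, m_apply]; dsimp only
    rw [pRatPow_ofAdd_one, show (-2 : ℚ) = ((-2 : ℤ) : ℚ) from by norm_num, pRatPow_ofAdd_intCast,
      qdd_eq, ← zpow_add_one, show (-2 : ℤ) + 1 = -1 from by norm_num, zpow_neg_one]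

/-- **NON-VACUITY TWIN of the function-level Prop 1.5 (iii) theorem (p458029) at `modelχq p 1 2`: a `ThetaKummerInput` —
the monomial module «`c·Ü^r·Θ̈^s`» — realising ALL its binders at ONE datum**, with GENUINE `κ(Θ̈) = η̈♯ = etaDdχq`:
bijective `Λ(Fn) ≅ Δ_Θ`, `ConstCompat kummerDataχq`, `infl log(Ü) = κ(Ü)`, `infl zClassYddχq = κ(Θ̈) = etaDdχq`, and
Prop 1.4 (ii) as FUNCTION identities: `σ₀ • Ü = const(u·q̈)·Ü`, `y • Ü = const(±1)·Ü`, `σ₀ • Θ̈ = const(u′·q̈⁻¹)·Ü⁻²·Θ̈`,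
`y • Θ̈ = const(1)·Θ̈` (`σ₀ = (a,1)`, `y ∈ Π^tp_Y`). [cite: MochizukiEtTh2009, Prop 1.4 (ii) p.22] -/
theorem exists_thetaKummerInput_functionModule_modelTate :
    ∃ (T : (ThetaSetting.modelχq p 1 2 even_two).ThetaKummerInput) (udd : T.Fn)
      (hu : letI := T.instAction; udd ∈ MulAction.fixedPoints (ThetaSetting.modelχq p 1 2 even_two).GtpYdd T.Fn)
      (w : RootSystem udd), letI := T.instAction
      Function.Bijective T.coeff.hom ∧ T.ConstCompat (kummerDataχq p 1 2 even_two) ∧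
      (ThetaSetting.modelχq p 1 2 even_two).inflTheta (ThetaSetting.modelχq p 1 2 even_two).GtpYdd
          (kummerCoreχq p 1 2 even_two).logUdd =
        T.coeff.kummerContClass (ThetaSetting.modelχq p 1 2 even_two).GtpYdd w hu (fun _ => T.isOpen_stabilizer _) ∧
      etaDdχq p 1 2 even_two = T.kummerTheta ∧
      (∃ u ∈ (ThetaSetting.modelχq p 1 2 even_two).unitsOKdd,
        (SemidirectProduct.inl (gfpOf (FreeGroup.of 0)) : PiTpχq p 1 2) • udd =
          T.const (u * (ThetaSetting.modelχq p 1 2 even_two).qddUnit) * udd) ∧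
      (∀ y ∈ (ThetaSetting.modelχq p 1 2 even_two).GtpY,
        ∃ u ∈ (ThetaSetting.modelχq p 1 2 even_two).unitsOKdd, y • udd = T.const u * udd) ∧
      (∃ u ∈ (ThetaSetting.modelχq p 1 2 even_two).unitsOKdd,
        (SemidirectProduct.inl (gfpOf (FreeGroup.of 0)) : PiTpχq p 1 2) • T.theta =
          T.const (u * (ThetaSetting.modelχq p 1 2 even_two).qddUnit⁻¹) * udd ^ (-(2 : ℤ)) * T.theta) ∧
      (∀ y ∈ (ThetaSetting.modelχq p 1 2 even_two).GtpY,
        ∃ u ∈ (ThetaSetting.modelχq p 1 2 even_two).unitsOKdd, y • T.theta = T.const u * T.theta) := by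
  obtain ⟨B, hB, hBopen, hBYU, hBYT, hBlogU, hBZ, hB0U, hB0T⟩ := exists_exponentCocycle_modelTate p
  obtain ⟨T, udd, hu, w, h1, h2, h3, h4, h5, h6, h7, h8⟩ :=
    (kummerCoreχq p 1 2 even_two).exists_thetaKummerInput_of_exponentCocycle (yCoordKitχq p 1 2 even_two) rfl
      (fun t => by
        show deltaThetaCoordχq p 1 2 (cycEquiv p ((cycEquiv p).symm t)) = deltaThetaCoordχq p 1 2 t
        rw [MulEquiv.apply_symm_apply])
      (zFunχq p 1 2 even_two _ le_rfl) (zFunχq_mem p 1 2 even_two _ le_rfl)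
      (SemidirectProduct.inl (gfpOf (FreeGroup.of 0))) (toZ_inl_gfpOf_a p 1 2 even_two) B hB hBopen hBYU hBYT hBlogU hBZ
      1 (Or.inl rfl) hB0U hB0T
  refine ⟨T, udd, hu, w, h1, h2, h3, ?_, h5, h6, h7, h8⟩
  rw [← h4, etaDdχq_def, ← res_zClassYχq]
  rfl

/-- **[EtTh] Prop 1.5 (iii) at `η̈♯ = etaDdχq p 1 2` RE-DERIVED THROUGH THE KUMMER THEORY OF FUNCTIONS**: for the étale-theta
datum carrying `etaDdχq` over abc-iut-w5-d171's `kummerDataχq`, `Prop15iii` holds — by abc-iut-L2-t12's function-level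
theorem (p458029) applied to the theta function module of `exists_exponentCocycle_modelTate` (`x′ = zClassYddχq`,
`res x′ = log(Θ)` by abc-iut-L2-t6's `res_zClassYddχq_eq_logTheta`). abc-iut-L2-t6's F7q reached the same conclusion
by class-level displays; this is the function-level route of print («follows from Props 1.3; 1.4 (ii), (iii)»).
[cite: MochizukiEtTh2009, Prop 1.5 (iii) p.23] -/
theorem prop15iii_etaDdχq_of_functionModule (hC : (ThetaSetting.modelχq p 1 2 even_two).Compat) :
    ThetaSetting.Prop15iii ((kummerDataχq p 1 2 even_two).etaleThetaDataOfClass (etaDdχq p 1 2 even_two)) hC := by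
  obtain ⟨B, hB, hBopen, hBYU, hBYT, hBlogU, hBZ, hB0U, hB0T⟩ := exists_exponentCocycle_modelTate p
  have hres : ContH1.res (MonoidHom.id (ThetaSetting.modelχq p 1 2 even_two).GtpTheta)
      (ThetaSetting.modelχq p 1 2 even_two).DeltaTheta
      (hC.deltaTheta_le_DtpYddTheta.trans (Subgroup.map_mono inf_le_left))
      (ContH1.res (MonoidHom.id (ThetaSetting.modelχq p 1 2 even_two).GtpTheta)
        (ThetaSetting.modelχq p 1 2 even_two).DeltaTheta (ThetaSetting.modelχq p 1 2 even_two).GtpYddTheta_le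
        (ContH1.mk (zFunχq p 1 2 even_two _ le_rfl) (zFunχq_mem p 1 2 even_two _ le_rfl))) =
      (ThetaSetting.modelχq p 1 2 even_two).logTheta := by
    have h := res_zClassYddχq_eq_logTheta p 1 2 even_two hC
    rw [← res_zClassYχq] at h
    exact h
  obtain ⟨T, udd, hu, w, -, hcc, hlogU, hx', hU₀, hUY, hΘ₀, hΘY⟩ :=
    (kummerCoreχq p 1 2 even_two).exists_thetaKummerInput_of_exponentCocycle (yCoordKitχq p 1 2 even_two) rfl
      (fun t => by
        show deltaThetaCoordχq p 1 2 (cycEquiv p ((cycEquiv p).symm t)) = deltaThetaCoordχq p 1 2 t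
        rw [MulEquiv.apply_symm_apply])
      (zFunχq p 1 2 even_two _ le_rfl) (zFunχq_mem p 1 2 even_two _ le_rfl)
      (SemidirectProduct.inl (gfpOf (FreeGroup.of 0))) (toZ_inl_gfpOf_a p 1 2 even_two) B hB hBopen hBYU hBYT hBlogU hBZ
      1 (Or.inl rfl) hB0U hB0T
  rw [etaDdχq_def, ← res_zClassYχq]
  show ThetaSetting.Prop15iii ((kummerCoreχq p 1 2 even_two).toKummerData.etaleThetaDataOfClass
    ((ThetaSetting.modelχq p 1 2 even_two).inflTheta (ThetaSetting.modelχq p 1 2 even_two).GtpYdd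
      (ContH1.res (MonoidHom.id (ThetaSetting.modelχq p 1 2 even_two).GtpTheta)
        (ThetaSetting.modelχq p 1 2 even_two).DeltaTheta (ThetaSetting.modelχq p 1 2 even_two).GtpYddTheta_le
        (ContH1.mk (zFunχq p 1 2 even_two _ le_rfl) (zFunχq_mem p 1 2 even_two _ le_rfl))))) hC
  rw [hx']
  exact (kummerCoreχq p 1 2 even_two).prop15iii_etaleThetaDataOfClass_of_thetaKummerInput T hC hcc hu w hlogU _ hx'
    hres (toZ_inl_gfpOf_a p 1 2 even_two) hU₀ hUY hΘ₀ hΘY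

end Literature.AnabelianGeometry.EtaleTheta.SettingModel

end
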